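/- Copyright: the b2b-balaban cell (near-miss cell 7), T⁴-continuum fan-out; row NE7b CRUX team (2), seat
t4-ne7b-formalise-leaf-03 (gen 29) — custodian's build of the OWNER's INTERFACE REQUEST NE7b IR-52-1 «THE LATTICE-UNIT ROAD»
(RULING R-OWNER-52-3, journal l.35615), item (b) of 2: the road — the lattice-unit record `HistReadDataLWL` embedded into the
plug record at M5-2e's weight `cvol82` read at the LATTICE growth `(1+β₀)·L^d`, under leaf-06's LATTICE window `ellVolS82L`
(IR-51-1 part 2 §3), the window-explicit L-witness, and the terminal theorem over the new record.  Released under the licence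
of the surrounding project. -/
import Summits.QuantumFields.BalabanUV.T4Continuum.Support.HistoryRealiseCellsRunAssemblyWTVSLWP82
import Summits.QuantumFields.BalabanUV.T4Continuum.Support.HistoryRealiseCellsRunAssemblyWTVSDataLWL

/-!
# THE LATTICE-UNIT ROAD: `HistReadDataLWL.toLP82L`, THE WINDOW-EXPLICIT L-WITNESS AT `ellVolS82L`, AND THE TERMINAL THEOREM
# `continuumYM4Torus_of_histReadingLWL_fsc` (INTERFACE REQUEST NE7b IR-52-1 (b); re-open object (α) of row NE7b; custodian
# lineage `t4-ne7b-formalise-leaf-03` gen 29)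

Summits-side support leaf of the T⁴-continuum cell (rung (B)+1 on a FINITE torus only; NOT infinite volume, NOT the
mass gap, NOT the Clay statement; NOT a proof of the spine estimate NE7b — the cell's OWN estimate, NOT PRINTED, NOT
PROVED).  [folklore] composition BY NAME: one `def` (the embedding `HistReadDataLWL.toLP82L`, data-level — W5's `toLP82`
(p300797) with the record's lattice display `hΛL` feeding leaf-06's LATTICE fillers `volumeDisplaysS82L_of_log_eq_of_inInterval`
∕ `huθS82L_births_of_log_eq_of_inInterval` (p299984 §3) and W5 §0's `plug_of_shrunk82` VERBATIM, positionally — leaf-06 g37's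
junction certificate J1–J5, journal l.35677), its `_data` lemma and three theorems; no `[cite:]` tag, nothing printed asserted,
no `Prop` fact minted, zero `sorry`.  Append-only: every landed statement (`…LW_fsc` p290621, `…LWD_fsc`, `…LWK_fsc`,
`…LP_fsc` p300321, W5∕W6) UNCHANGED BY NAME AND TYPE; the terminal statement here is NEW because its record TYPE is new
(`HistReadDataLWL`, one more letter `M` in the prefix-outside parameter block) — not a re-declaration.

WHY (R-OWNER-52-3 (3)–(5)).  By name, before this file: the ROAD of record (W5∕W6) runs on the PER-CUBE letter `uvol` and the
per-cube window `ellVolS82`, on which NO census sentence of record is booked (its (WP1) root is the «gap-9 artefact»); the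
CENSUS of record (balaban-calc VOLUME-4 G40, CERTIFIED: «(WS1⁸²ᴸ) ℓ ≥ (6c₀∕64⁴)·ρ = 361.4645·ρ, NIL iff ρ ≤ 1.2067 ∣ 1.2487 ∣
1.3283 ∣ 1.4071 ∣ 1.4853 ∣ 1.5632, lag `jvol82 4 ((1+β₀)·13⁴) = 66`, weight `cvol82 4 66 13⁴`, THIN») is booked on the LATTICE
lemma `volumeDisplaysS82L_of_log_eq_of_inInterval` at `ellVolS82L`, which no road consumed — a located BY-NAME gap
(Q-ne7bleaf06-g37-1).  THIS FILE closes it: the road below consumes exactly that lemma at exactly that window, so «road of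
record = lattice road = census of record» can be said by name (the OWNER's WALL v1.27 wording, not this file's).

WHAT.  §1 **`plug82L_of_histReadingLWL`** (per term: the lattice prefix `InInterval e^{−ℓᵥ82ᴸ∕2} K` + the record's `hΛL K` ⊢
leaf-06's eight binders ⊢ W5 §0 `plug_of_shrunk82` at the weight `cvol82 d (jvol82 d ((1+β₀)·L^d)) ((1+β₀)·L^d)`, `L := F.L`);
**`HistReadDataLWL.toLP82L (Dd) (hIr) (hIvL) : HistReadDataLP …`** GIVEN the rounding window `InInterval e^{−ℓ⋆∕2} K` and the
LATTICE volume window `InInterval e^{−ℓᵥ82ᴸ∕2} K` (`ellVolS82L C d κ₂ κᵥ cΛ M F.L θᵥ ((1+β₀)·F.L^d) (jvol82 d ((1+β₀)·F.L^d))`)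
for every cutoff — `wV := cvol82 d (jvol82 d ((1+β₀)·L^d)) ((1+β₀)·L^d)`, `hwV` by `two_pow_le_cvol82`, `hplug := plug82L_…`,
`huV` by `huθS82L_births_of_log_eq_of_inInterval`, `hRR`∕`hRR′` by the owner's `roundingRoomF_unrounded_of_inInterval` (as W5),
everything else copied; `toLP82L_data`.  §2 **`nonempty_countRoadWitnessT3bWTVSL_of_histReadingLWL82`** (W4 §1 ∘ `toLP82L`).
§3 **`continuumYM4Torus_of_histReadingLWL_fsc`**: the headline predicate from SOME lattice-unit prefix record for all small
couplings — W4's `continuumYM4Torus_of_histReadingLP_fsc` ∘ `forSmallCouplings_mono_inInterval₂` at the closed thresholds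
`e^{−ℓ⋆∕2}` (rounding) and `e^{−ℓᵥ82ᴸ∕2}` (LATTICE volume) ∘ §1.

BY-NAME EFFECT (for the OWNER's WALL ∕ LEDGERS memo, not asserted here): the (α) object now has a road whose volume window
lemma IS the one the certified census sentence describes; classes unchanged (`hΛL` R = H3 ∕ M2-B; exponent rows ∕ signs
C-side; (WS1⁸²ᴸ)–(WS4⁸²ᴸ) = smallness of OUR letters inside `ForSmallCouplings`); the per-cube road W5∕W6 and its records stay
as they are (a second road, not withdrawn here — the OWNER words the record status).
HONEST SCOPE.  CONDITIONAL on everything the records display; ρ UNVALUED; the census numerals above are QUOTED from the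
OWNER's fold of balaban-calc G40, not computed or asserted in this file; nothing of Bałaban's asserted, instantiated or
discharged; NE7b NOT proved; spine 0∕9.  HONEST DEPENDENCY (cell): continuum YM on T⁴ ⇐ BetaPertH ∧ nine spine estimates
(0/9 proved); BetaPertH ⇐ (D1) ∧ (D4) ∧ CAP+tail; G-an2-4 gates asym, D1 and NE2/3/4.  This file changes none of it.
-/
open Finset MeasureTheory
open Literature.MathematicalPhysics.QuantumFieldTheory.Balaban1983to89
open T4PersistenceDictionary T4PersistentHistoryCount T4BankedInduction T4PrintedShapeBanking
open T4WeightBudget T4GlobalDenominator T4LiveClassFibration T4LiveStructureGas T4LiveGasToTerms T4RecordPriceSeam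
open T4PartnerMultiplicity T4IndicatorShell T4MatchingAssembly T4MatchingClosure T4MatchingClosureSocket T4Continuum
open T4StabilitySocket T4BranchingRecordsGas T4TaggedShapeBanking T4CanonicalMenus T4RenewalChains
open Summit.QuantumFields.BalabanUV.T4Continuum.PlacementBatch Summit.QuantumFields.BalabanUV.T4Continuum.PlacementSkeleton
open Summit.QuantumFields.BalabanUV.T4Continuum.CountThresholdUniform Summit.QuantumFields.BalabanUV.T4Continuum.CountThresholdExit
open Summit.QuantumFields.BalabanUV.T4Continuum.CountSeamJunction Summit.QuantumFields.BalabanUV.T4Continuum.LateMergers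
open Summit.QuantumFields.BalabanUV.T4Continuum.HistoryFlow Summit.QuantumFields.BalabanUV.T4Continuum.HistoryRegeneration
open Summit.QuantumFields.BalabanUV.T4Continuum.HistoryTables Summit.QuantumFields.BalabanUV.T4Continuum.HistoryAssemblyTrees
open Summit.QuantumFields.BalabanUV.T4Continuum.HistoryAssemblyTerms Summit.QuantumFields.BalabanUV.T4Continuum.HistoryAssemblyPedigree
open Summit.QuantumFields.BalabanUV.T4Continuum.HistoryConstants Summit.QuantumFields.BalabanUV.T4Continuum.HistoryGen
open Literature.MathematicalPhysics.QuantumFieldTheory.Balaban1983to89.B13ScaleTransfer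
open Summit.QuantumFields.BalabanUV.T4Continuum.ZoneSkeleton Summit.QuantumFields.BalabanUV.T4Continuum.HistorySocketTH
open Summit.QuantumFields.BalabanUV.T4Continuum.HistoryCaps Summit.QuantumFields.BalabanUV.T4Continuum.HistoryAssemblyPrice
open Summit.QuantumFields.BalabanUV.T4Continuum.HistoryBankingLE Summit.QuantumFields.BalabanUV.T4Continuum.HistoryExitLE
open Summit.QuantumFields.BalabanUV.T4Continuum.HistoryAssemblyTreesLE Summit.QuantumFields.BalabanUV.T4Continuum.HistoryAssemblyTermsLE
open Summit.QuantumFields.BalabanUV.T4Continuum.HistoryRealise Summit.QuantumFields.BalabanUV.T4Continuum.HistoryAssemblyRealiseLE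
open Summit.QuantumFields.BalabanUV.T4Continuum.HistoryAssemblyMult Summit.QuantumFields.BalabanUV.T4Continuum.HistoryAssemblyMultKey
open Summit.QuantumFields.BalabanUV.T4Continuum.HistoryAssemblyRealiseRun Summit.QuantumFields.BalabanUV.T4Continuum.HistoryAssemblyRealiseMult
open Summit.QuantumFields.BalabanUV.T4Continuum.HistoryZones Summit.QuantumFields.BalabanUV.T4Continuum.HistoryRealiseCells
open Summit.QuantumFields.BalabanUV.T4Continuum.HistoryRealiseCellsRun Summit.QuantumFields.BalabanUV.T4Continuum.HistoryAssemblyRealiseRunMult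
open Summit.QuantumFields.BalabanUV.T4Continuum.HistoryRealiseCellsRunMult Summit.QuantumFields.BalabanUV.T4Continuum.HistoryAssemblyMultInstance
open Summit.QuantumFields.BalabanUV.T4Continuum.HistoryJoinsPlacedMember Summit.QuantumFields.BalabanUV.T4Continuum.PlacementSkeleton
open Summit.QuantumFields.BalabanUV.T4Continuum.HistoryJoinsPlacedMult Summit.QuantumFields.BalabanUV.T4Continuum.HistoryRealiseDistinct
open Summit.QuantumFields.BalabanUV.T4Continuum.HistoryRegionTemplates Summit.QuantumFields.BalabanUV.T4Continuum.HistoryCaps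
open Summit.QuantumFields.BalabanUV.T4Continuum.HistoryZoneEvolve (cth)
open Literature.MathematicalPhysics.QuantumFieldTheory.Balaban1983to89.B16SProfile (DropCtl)
open Summit.QuantumFields.BalabanUV.T4Continuum.HistoryRealiseCellsRunMultEnd Summit.QuantumFields.BalabanUV.T4Continuum.HistoryRealiseCellsRunMultEndD
open Summit.QuantumFields.BalabanUV.T4Continuum.HistoryRealiseCellsRunPinnedT3b Summit.QuantumFields.BalabanUV.T4Continuum.HistoryHybridRescale
open Summit.QuantumFields.BalabanUV.T4Continuum.HistoryRealiseCellsRunApex (exists_const_schemeZ)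
open Summit.QuantumFields.BalabanUV.T4Continuum.HistoryRealisePrint Summit.QuantumFields.BalabanUV.T4Continuum.HistoryRealiseWeak
open Summit.QuantumFields.BalabanUV.T4Continuum.HistoryRealisePrintReading Summit.QuantumFields.BalabanUV.T4Continuum.HistoryRealiseWeakReading
open Summit.QuantumFields.BalabanUV.T4Continuum.HistoryRealisePrintCells Summit.QuantumFields.BalabanUV.T4Continuum.HistoryRealiseWeakCells
open Summit.QuantumFields.BalabanUV.T4Continuum.HistoryRealiseCellsRunApexT3b Summit.QuantumFields.BalabanUV.T4Continuum.HistoryRealiseCellsRunApexT3bW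

open Summit.QuantumFields.BalabanUV.T4Continuum.HistoryRealiseCellsRunApexT3bWT Summit.QuantumFields.BalabanUV.T4Continuum.HistoryRealiseCellsRunPinnedT3bWT
open Summit.QuantumFields.BalabanUV.T4Continuum.HistoryRealiseCellsRunHeadlineT3bWT
open Summit.QuantumFields.BalabanUV.T4Continuum.HistoryRealiseCellsRunApexT3bWTV Summit.QuantumFields.BalabanUV.T4Continuum.HistoryBankingVolumePlug
open Summit.QuantumFields.BalabanUV.T4Continuum.HistoryRealiseCellsRunApexT3bWTVS
open Summit.QuantumFields.BalabanUV.T4Continuum.HistoryGenealogyRealise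
open Summit.QuantumFields.BalabanUV.T4Continuum.HistoryGenealogyInstantiate
open Summit.QuantumFields.BalabanUV.T4Continuum.B16HistoryIndexedRepr
open Summit.QuantumFields.BalabanUV.T4Continuum.B16HistoryIndexedTrunc
open Summit.QuantumFields.BalabanUV.T4Continuum.HistoryBankingDiscountCharge
open Summit.QuantumFields.BalabanUV.T4Continuum.HistoryBankingCreditRead
open Summit.QuantumFields.BalabanUV.T4Continuum.HistoryBankingFibreRoom
open Summit.QuantumFields.BalabanUV.T4Continuum.HistoryPriceKeys
open Summit.QuantumFields.BalabanUV.T4Continuum.HistoryRealiseCellsRunSupplyWTVS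
open Summit.QuantumFields.BalabanUV.T4Continuum.HistoryRealiseCellsRunSupplyKeysWTVS

open Summit.QuantumFields.BalabanUV.T4Continuum.HistoryRealiseCellsRunAssemblyWTVSData
open Summit.QuantumFields.BalabanUV.T4Continuum.HistoryRealiseCellsRunAssemblyWTVSDataL
open Summit.QuantumFields.BalabanUV.T4Continuum.HistoryRealiseCellsRunAssemblyWTVSDataLW
open Summit.QuantumFields.BalabanUV.T4Continuum.HistoryRealiseCellsRunAssemblyWTVSL
open Summit.QuantumFields.BalabanUV.T4Continuum.HistoryRealiseCellsRunApexT3bWTVSL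
open Summit.QuantumFields.BalabanUV.T4Continuum.HistoryBankingSharpShares (sBsharp)
open Summit.QuantumFields.BalabanUV.T4Continuum.HistoryBankingRoundingSupply (ellStar)
open Summit.QuantumFields.BalabanUV.T4Continuum.HistoryBankingRoundingUnrounded (sRunr ApFlat)
open Summit.QuantumFields.BalabanUV.T4Continuum.HistoryBankingRoundingTuned
open Summit.QuantumFields.BalabanUV.T4Continuum.HistoryBankingVolumeWindow
open Summit.QuantumFields.BalabanUV.T4Continuum.HistoryBankingVolumeSupply

open Summit.QuantumFields.BalabanUV.T4Continuum.HistoryBankingForestVolume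
open Summit.QuantumFields.BalabanUV.T4Continuum.HistoryBankingForestPlug
open Summit.QuantumFields.BalabanUV.T4Continuum.HistoryBankingAnchors82
open Summit.QuantumFields.BalabanUV.T4Continuum.HistoryBankingShrunkLedger82
open Summit.QuantumFields.BalabanUV.T4Continuum.HistoryBankingShrunkWitness82
open Summit.QuantumFields.BalabanUV.T4Continuum.HistoryBankingVolumeWindowCollar
open Summit.QuantumFields.BalabanUV.T4Continuum.HistoryBankingVolumeWindowShrunk82
open Summit.QuantumFields.BalabanUV.T4Continuum.B16HistoryWeightPlugW
open Summit.QuantumFields.BalabanUV.T4Continuum.HistoryRealiseCellsRunSupplyWTVSW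
open Summit.QuantumFields.BalabanUV.T4Continuum.HistoryRealiseCellsRunAssemblyWTVSDataLW
open Summit.QuantumFields.BalabanUV.T4Continuum.HistoryRealiseCellsRunAssemblyWTVSDataLP
open Summit.QuantumFields.BalabanUV.T4Continuum.HistoryRealiseCellsRunAssemblyWTVSLW
open Summit.QuantumFields.BalabanUV.T4Continuum.HistoryRealiseCellsRunAssemblyWTVSLP
open Summit.QuantumFields.BalabanUV.T4Continuum.HistoryBankingVolumeWindowLattice
open Summit.QuantumFields.BalabanUV.T4Continuum.HistoryRealiseCellsRunAssemblyWTVSLWP82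
open Summit.QuantumFields.BalabanUV.T4Continuum.HistoryRealiseCellsRunAssemblyWTVSDataLWL

namespace Summit.QuantumFields.BalabanUV.T4Continuum.HistoryRealiseCellsRunAssemblyWTVSLWLP82

noncomputable section

set_option synthInstance.maxSize 1024

/-! ## §1 The embedding at M5-2e's weight read at the lattice growth, under the lattice window -/

section Embed

variable {F : T4Family} {G : Type*} [GaugeGroup G] [MeasurableSpace G] [HaarData G] [RegularGaugeGroup G]
  {D : FiniteEpsData F G} {C : T4PrintedShapeBanking.Consts} {O : PrintedO1s} {θv : ℝ} {rr d n : ℕ} {hn : 0 < n}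
  {g₀ : ℕ → ℝ} {os : List (ULoop F)} {cΛ M Lr Φ β₀ : ℝ} {p₁ η η' κ κ₂ κᵥ : ℕ} {DomK : ℕ → Type}
  {I : (K : ℕ) → HIndex (DomK K)} [DecidableEq (HIndex.Idx I)] {DomK' : ℕ → Type} {I' : (K : ℕ) → HIndex (DomK' K)}
  {Xs : ℕ → Type} [∀ K, MeasurableSpace (Xs K)] {μ : (K : ℕ) → Measure (Xs K)} [∀ K, IsFiniteMeasure (μ K)]
  {𝒢 : (K : ℕ) → GoodClass (Xs K)} {Y : ℕ → Type} [∀ K, MeasurableSpace (Y K)] {νB : (K : ℕ) → Measure (Y K)}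
  [∀ K, IsFiniteMeasure (νB K)] {𝒢' : (K : ℕ) → GoodClass (Y K)}

omit [RegularGaugeGroup G] in
/-- **THE PLUG OF A LATTICE-UNIT PREFIX RECORD AT M5-2e's LEDGER, per term** (leaf-06 g37's J1+J2 on the record): under the
LATTICE volume window `InInterval e^{−ℓᵥ82ᴸ∕2} K`, leaf-06's `volumeDisplaysS82L_of_log_eq_of_inInterval` at the record's
`hΛL K` — fed by `hexpFL hdq hexpVL`, the signs, `1 ≤ F.L` (derived), (2.7) `h27`, (2.9) `h29` and (2.5) `isRj` at `L := F.L` —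
supplies (E4)'s eight binders on `u = log ∘ Λ K`, and W5 §0 `plug_of_shrunk82` turns them into the plug at
`w = cvol82 d (jvol82 d ((1+β₀)·L^d)) ((1+β₀)·L^d)` on the run read off each term. [folklore] -/
theorem plug82L_of_histReadingLWL
    (Dd : HistReadDataLWL D C O θv rr d n hn g₀ os cΛ M Lr Φ β₀ p₁ η η' κ κ₂ κᵥ I I' Xs μ 𝒢 Y νB 𝒢')
    (hIvL : ∀ K, (D.C ⟨K, F.m, g₀ K⟩).flow.InInterval
      (Real.exp (-(ellVolS82L C d κ₂ κᵥ cΛ M F.L θv ((1 + β₀) * F.L ^ d) (jvol82 d ((1 + β₀) * F.L ^ d)) / 2))) K) :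
    ∀ K, Dd.K₀ ≤ K → ∀ τ ∈ HIndex.termSet I K, ∀ x ∈ (Dd.ℛ.inputOf.run K τ).histV.comp K,
      Real.exp (treeVol Dd.ℛ.L (Dd.ℛ.s K) (fun v => (v : ℝ)) (Dd.ℛ.inputOf.run K τ).pedMV
          (fun j => Real.log (Dd.Φf.Λ K j)) K (K, x)) ≤
        Real.exp (lifeCost (dictWT Prod.fst (Dd.ℛ.R K) C.n₁) (costT Prod.fst C K (Dd.ℛ.R K))
            ((Dd.ℛ.inputOf.run K τ).pedMV.genT (K, x))) *
          Real.exp (birthWT Prod.fst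
            (fun m => cvol82 d (jvol82 d ((1 + β₀) * F.L ^ d)) ((1 + β₀) * F.L ^ d) * Real.log (Dd.Φf.Λ K m))
            ((Dd.ℛ.inputOf.run K τ).pedMV.genT (K, x))) := by
  intro K hK τ hτ
  obtain ⟨⟨a, h, l, c⟩, -, hpe⟩ := Finset.mem_map.mp hτ
  have hτe : τ = ⟨K, a, (h, l, c)⟩ := hpe.symm
  subst hτe
  have hL0 : 0 < Dd.ℛ.L := by rw [Dd.hL]; exact lt_of_lt_of_le (by norm_num) (two_le_L F)
  have hL4 : 4 ≤ Dd.ℛ.L := by rw [Dd.hL]; exact Dd.hL4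
  have hL1 : 1 ≤ F.L := le_trans (by norm_num) (two_le_L F)
  have hdrop : ∀ m, DropCtl (Dd.ℛ.s K) m := by rw [Dd.hs]; exact Dd.hdrop K hK
  -- leaf-06's eight binders at the pinned LATTICE cost, this cutoff (IR-51-1 part 2 §3)
  have vd : VolumeDisplaysS82 C d K (Dd.ℛ.R K) (fun t => Real.log (Dd.Φf.Λ K t)) ((1 + β₀) * F.L ^ d)
      (jvol82 d ((1 + β₀) * F.L ^ d)) :=
    volumeDisplaysS82L_of_log_eq_of_inInterval (D.C ⟨K, F.m, g₀ K⟩).flow (hIvL K) (Dd.hΛL K) Dd.hexpFL Dd.hdq Dd.hexpVL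
      Dd.hκ₂ Dd.hκᵥ Dd.hcΛ Dd.hMΛ hL1 Dd.hE₂ Dd.hE₃pos Dd.hθv Dd.hA₀.ne' Dd.hβ₀ Dd.hp27 (Dd.h27 K hK) (Dd.h29 K hK)
      (fun t ht => Dd.isRj K t ht) le_rfl
  simp only [HistReading.run_inputOf]
  exact plug_of_shrunk82 (I := Dd.ℛ.runOf K a (h, l, c)) (C := C) (Dd.hN K hK _ hτ) (Dd.hRm K hK _ hτ) (Dd.hRmS K hK _ hτ)
    (Dd.hRm2 K hK _ hτ) (Dd.hD K hK _ hτ) hL0 hL4 hdrop (Dd.one_le_R K hK) Dd.hn₁ Dd.hE₂.le Dd.hE₃pos.le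
    (fun j => Dd.Φf.one_le_Λ K j) vd.hΓ0 vd.hΓ vd.hj1 vd.hsmall vd.huS vd.huE₂ vd.huE₃

omit [RegularGaugeGroup G] in
/-- **THE IR-52-1 EMBEDDING**: a lattice-unit prefix record `HistReadDataLWL` together with the rounding window
`InInterval e^{−ℓ⋆∕2} K` and the LATTICE volume window `InInterval e^{−ℓᵥ82ᴸ∕2} K` for every cutoff IS a plug record
`HistReadDataLP` at the weight `cvol82 d (jvol82 d ((1+β₀)·L^d)) ((1+β₀)·L^d)` — `hRR`∕`hRR′` by the owner's
`roundingRoomF_unrounded_of_inInterval` (as W5's `toLP82`), `hwV` by `two_pow_le_cvol82`, `hplug := plug82L_of_histReadingLWL`,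
`huV` by leaf-06's `huθS82L_births_of_log_eq_of_inInterval` on the members' performed births, everything else copied
(`sR`∕`sR′ := sRunr …`, `hE₃ := hE₃pos.le`). [folklore] -/
def _root_.Summit.QuantumFields.BalabanUV.T4Continuum.HistoryRealiseCellsRunAssemblyWTVSDataLWL.HistReadDataLWL.toLP82L
    (Dd : HistReadDataLWL D C O θv rr d n hn g₀ os cΛ M Lr Φ β₀ p₁ η η' κ κ₂ κᵥ I I' Xs μ 𝒢 Y νB 𝒢')
    (hIr : ∀ K, (D.C ⟨K, F.m, g₀ K⟩).flow.InInterval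
      (Real.exp (-(ellStar C O F.L (O.d + 3) η η' κ (ApFlat O.γ₀ O.A₁ O.M Lr O.d) Φ / 2))) K)
    (hIvL : ∀ K, (D.C ⟨K, F.m, g₀ K⟩).flow.InInterval
      (Real.exp (-(ellVolS82L C d κ₂ κᵥ cΛ M F.L θv ((1 + β₀) * F.L ^ d) (jvol82 d ((1 + β₀) * F.L ^ d)) / 2))) K) :
    HistReadDataLP D C O θv rr d n hn g₀ os I I' Xs μ 𝒢 Y νB 𝒢' :=
  have hL1 : 1 ≤ F.L := le_trans (by norm_num) (two_le_L F)
  have hΓ0 : (0 : ℝ) ≤ (1 + β₀) * F.L ^ d := by have := Dd.hβ₀; positivity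
  { l₀ := Dd.l₀, vol := Dd.vol, l₀_pos := Dd.l₀_pos, vol_pos := Dd.vol_pos, K₀ := Dd.K₀, RA := Dd.RA, ρA := Dd.ρA,
    holdsA := Dd.holdsA, intA := Dd.intA, H2A := Dd.H2A, ℛ := Dd.ℛ, hL := Dd.hL, hs := Dd.hs, Φf := Dd.Φf,
    hR := Dd.hR, isRj := Dd.isRj, one_le_R := Dd.one_le_R, hL4 := Dd.hL4, hprof := Dd.hprof, hdrop := Dd.hdrop,
    hN := Dd.hN, hRm := Dd.hRm, hRmS := Dd.hRmS, hRm2 := Dd.hRm2, hD := Dd.hD, hreg := Dd.hreg, hn₁ := Dd.hn₁,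
    hE₂ := Dd.hE₂, hE₃ := Dd.hE₃pos.le,
    -- IR-52-1: M5-2e's weight at the LATTICE growth, its floor, THE PLUG and the slack at that weight
    wV := fun _ => cvol82 d (jvol82 d ((1 + β₀) * F.L ^ d)) ((1 + β₀) * F.L ^ d),
    hwV := fun _ _ => two_pow_le_cvol82 d _ hΓ0,
    hplug := plug82L_of_histReadingLWL Dd hIvL,
    sB := Dd.sB,
    sR := fun K => sRunr O.γ₀ O.A₁ O.M Lr O.β₀ O.d p₁ (Dd.ℛ.R K) (D.C ⟨K, F.m, g₀ K⟩).flow.g,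
    φB := Dd.φB, φR := Dd.φR, β' := Dd.β', β₀ := β₀, hF := Dd.hF,
    hRR := fun K hK =>
      roundingRoomF_unrounded_of_inInterval (D.C ⟨K, F.m, g₀ K⟩).flow (hIr K) Dd.hexpR Dd.hexpR' Dd.hexpB Dd.hη Dd.hη'
        Dd.hκ Dd.hp₀ Dd.hAp Dd.hγ₀ Dd.hA₁ Dd.hA₀ Dd.hM Dd.hLr Dd.hβd Dd.hΦ Dd.hE₂ Dd.hE₃pos.le hL1 Dd.hm (Dd.h29 K hK)
        (fun j hj => Dd.isRj K j hj) (Dd.one_le_R K hK) le_rfl (Dd.hφB K) (Dd.hφR K) (Dd.hsB K),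
    h29 := Dd.h29,
    huV := fun K _ τ _ q hq => by
      obtain ⟨c, hc, rfl⟩ := mem_memOf.1 hq
      obtain ⟨x, -, rfl⟩ := Finset.mem_image.1 hc
      exact huθS82L_births_of_log_eq_of_inInterval (D.C ⟨K, F.m, g₀ K⟩).flow (hIvL K) (Dd.hΛL K) Dd.hexpFL Dd.hdq
        Dd.hexpVL Dd.hκ₂ Dd.hκᵥ Dd.hcΛ Dd.hMΛ hL1 Dd.hE₂ Dd.hE₃pos Dd.hθv Dd.hA₀.ne' Dd.hβ₀ (fun t ht => Dd.isRj K t ht)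
        le_rfl Prod.fst _ (births_le_of_step_le _ _ le_rfl),
    W := Dd.W, one_le_W := Dd.one_le_W, Wi := Dd.Wi, BAi := Dd.BAi, mi := Dd.mi, hWi := Dd.hWi, hBA := Dd.hBA,
    hmi := Dd.hmi, hρ := Dd.hρ, c₀ := Dd.c₀, n₁ := Dd.n₁, c₀_pos := Dd.c₀_pos, floor := Dd.floor,
    floor' := Dd.floor', sites := Dd.sites, sites' := Dd.sites', RB := Dd.RB, ρB := Dd.ρB, holdsB := Dd.holdsB,
    intB := Dd.intB, H2B := Dd.H2B, trunc := Dd.trunc, htr := Dd.htr, dB := Dd.dB, mup := Dd.mup, sB' := Dd.sB',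
    φB' := Dd.φB',
    sR' := fun K => sRunr O.γ₀ O.A₁ O.M Lr O.β₀ O.d p₁ (Dd.ℛ.R K) (D.C ⟨K, F.m, g₀ K⟩).flow.g,
    φR' := Dd.φR',
    hRR' := fun K hK =>
      roundingRoomF_unrounded_of_inInterval (D.C ⟨K, F.m, g₀ K⟩).flow (hIr K) Dd.hexpR Dd.hexpR' Dd.hexpB Dd.hη Dd.hη'
        Dd.hκ Dd.hp₀ Dd.hAp Dd.hγ₀ Dd.hA₁ Dd.hA₀ Dd.hM Dd.hLr Dd.hβd Dd.hΦ Dd.hE₂ Dd.hE₃pos.le hL1 Dd.hm (Dd.h29 K hK)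
        (fun j hj => Dd.isRj K j hj) (Dd.one_le_R K hK) le_rfl (Dd.hφB' K) (Dd.hφR' K) (Dd.hsB' K),
    upB := Dd.upB, deadB_nonneg := Dd.deadB_nonneg, resumB := Dd.resumB, mup_bd := Dd.mup_bd, shA := Dd.shA,
    shB := Dd.shB, Wsh := Dd.Wsh, shell := Dd.shell, Cc := Dd.Cc, Rr := Dd.Rr, CcRec := Dd.CcRec, RrRec := Dd.RrRec,
    ν := Dd.ν, u := Dd.u, s₂ := Dd.s₂, q₀ := Dd.q₀, r := Dd.r, s := Dd.s, budget := Dd.budget, sum_r := Dd.sum_r,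
    sum_u := Dd.sum_u, sum_s := Dd.sum_s, sum_s₂ := Dd.sum_s₂ }

omit [RegularGaugeGroup G] in
/-- the embedding keeps the reading, the threshold, the factor data, the source radius and the truncation and FIXES the
weight to M5-2e's `cvol82` read at the LATTICE growth `(1+β₀)·L^d` and its lag `jvol82 d ((1+β₀)·L^d)` [folklore] -/
theorem _root_.Summit.QuantumFields.BalabanUV.T4Continuum.HistoryRealiseCellsRunAssemblyWTVSDataLWL.HistReadDataLWL.toLP82L_data
    (Dd : HistReadDataLWL D C O θv rr d n hn g₀ os cΛ M Lr Φ β₀ p₁ η η' κ κ₂ κᵥ I I' Xs μ 𝒢 Y νB 𝒢')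
    (hIr : ∀ K, (D.C ⟨K, F.m, g₀ K⟩).flow.InInterval
      (Real.exp (-(ellStar C O F.L (O.d + 3) η η' κ (ApFlat O.γ₀ O.A₁ O.M Lr O.d) Φ / 2))) K)
    (hIvL : ∀ K, (D.C ⟨K, F.m, g₀ K⟩).flow.InInterval
      (Real.exp (-(ellVolS82L C d κ₂ κᵥ cΛ M F.L θv ((1 + β₀) * F.L ^ d) (jvol82 d ((1 + β₀) * F.L ^ d)) / 2))) K) :
    (Dd.toLP82L hIr hIvL).ℛ = Dd.ℛ ∧ (Dd.toLP82L hIr hIvL).K₀ = Dd.K₀ ∧ (Dd.toLP82L hIr hIvL).Φf = Dd.Φf ∧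
      (Dd.toLP82L hIr hIvL).l₀ = Dd.l₀ ∧ (Dd.toLP82L hIr hIvL).trunc = Dd.trunc ∧
      ((Dd.toLP82L hIr hIvL).wV = fun _ => cvol82 d (jvol82 d ((1 + β₀) * F.L ^ d)) ((1 + β₀) * F.L ^ d)) :=
  ⟨rfl, rfl, rfl, rfl, rfl, rfl⟩

end Embed

/-! ## §2 The L-witness on M5-2e's ledger from a lattice-unit prefix record, window-explicit at `ellVolS82L` -/

section Assembly

variable {F : T4Family} {G : Type*} [GaugeGroup G] [MeasurableSpace G] [HaarData G] [RegularGaugeGroup G]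
  {D : FiniteEpsData F G} {C : T4PrintedShapeBanking.Consts} {O : PrintedO1s} {θv : ℝ} {rr d n : ℕ} {hn : 0 < n}
  {g₀ : ℕ → ℝ} {os : List (ULoop F)} {cΛ M Lr Φ β₀ : ℝ} {p₁ η η' κ κ₂ κᵥ : ℕ} {DomK : ℕ → Type}
  {I : (K : ℕ) → HIndex (DomK K)} [DecidableEq (HIndex.Idx I)] {DomK' : ℕ → Type} {I' : (K : ℕ) → HIndex (DomK' K)}
  {Xs : ℕ → Type} [∀ K, MeasurableSpace (Xs K)] {μ : (K : ℕ) → Measure (Xs K)} [∀ K, IsFiniteMeasure (μ K)]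
  {𝒢 : (K : ℕ) → GoodClass (Xs K)} {Y : ℕ → Type} [∀ K, MeasurableSpace (Y K)] {νB : (K : ℕ) → Measure (Y K)}
  [∀ K, IsFiniteMeasure (νB K)] {𝒢' : (K : ℕ) → GoodClass (Y K)}

omit [RegularGaugeGroup G] in
/-- **THE L-WITNESS FROM A LATTICE-UNIT PREFIX RECORD ON M5-2e's LEDGER** (W4 §1 ∘ `toLP82L`): the window-explicit statement
at the rounding threshold `e^{−ℓ⋆∕2}` and the LATTICE volume threshold `e^{−ℓᵥ82ᴸ∕2}` — the window lemma the certified census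
sentence VOLUME-4 describes is the one consumed. [folklore] -/
theorem nonempty_countRoadWitnessT3bWTVSL_of_histReadingLWL82
    (Dd : HistReadDataLWL D C O θv rr d n hn g₀ os cΛ M Lr Φ β₀ p₁ η η' κ κ₂ κᵥ I I' Xs μ 𝒢 Y νB 𝒢')
    (hIr : ∀ K, (D.C ⟨K, F.m, g₀ K⟩).flow.InInterval
      (Real.exp (-(ellStar C O F.L (O.d + 3) η η' κ (ApFlat O.γ₀ O.A₁ O.M Lr O.d) Φ / 2))) K)
    (hIvL : ∀ K, (D.C ⟨K, F.m, g₀ K⟩).flow.InInterval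
      (Real.exp (-(ellVolS82L C d κ₂ κᵥ cΛ M F.L θv ((1 + β₀) * F.L ^ d) (jvol82 d ((1 + β₀) * F.L ^ d)) / 2))) K) :
    Nonempty (CountRoadWitnessT3bWTVSL D C O θv rr d n hn g₀ os (HIndex.Idx I) (ℕ × Lab d) (Lab d)) :=
  nonempty_countRoadWitnessT3bWTVSL_of_histReadingLP (Dd.toLP82L hIr hIvL)

end Assembly

/-! ## §3 The terminal theorem: the headline from SOME lattice-unit prefix record, for all small couplings -/

section SU

variable {F : T4Family} {N : ℕ} [NeZero N] {ℰ : LoopAverage (Matrix.specialUnitaryGroup (Fin N) ℂ)}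

/-- **THE HEADLINE PREDICATE FROM A READING OF (1.72) UNDER THE HEADLINE's OWN PREFIX, VOLUME LETTER IN LATTICE UNITS**
(IR-52-1 (b)): `T4ContinuumYM4Torus.ContinuumYM4Torus D` for (0.4)-block-averaged data on `SU(N)` with a measurable
small-loop average, GIVEN `(B)` and `BetaPertHyp` BY NAME, the sign conventions, END v3.1's constants-only side conditions
(`0 < θ`, split slack, NO `hθJ`), ELEVEN window-threshold letters `cΛ M Lr Φ b₀ p₁ η η′ κ κ₂ κᵥ` (bound HERE, outside the
prefix — the D-48-1 CAVEAT; `M` is the lattice letter's cube side), and — for all small-coupling tuned runs and every loop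
string — SOME lattice-unit prefix record `HistReadDataLWL …` (skeletons, spaces, measures existentially).  Proof: W4's
`continuumYM4Torus_of_histReadingLP_fsc` ∘ the owner's two-window junction `forSmallCouplings_mono_inInterval₂` at the closed
thresholds `e^{−ℓ⋆∕2}` (rounding) and `e^{−ℓᵥ82ᴸ∕2}` (LATTICE volume, `ellVolS82L … F.L … ((1+b₀)·F.L^d) (jvol82 d ((1+b₀)·F.L^d))`)
∘ §1 `toLP82L`.  A NEW statement only because the record TYPE is new (the `_fsc` family is window-blind: `ForSmallCouplings`
absorbs the thresholds — R-OWNER-52-1); the census sentences are about §1∕§2's window lemma, never about this statement.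
CONDITIONAL on everything the record displays; NE7b NOT proved; count 0∕9. [folklore] -/
theorem continuumYM4Torus_of_histReadingLWL_fsc (D : FiniteEpsData F (Matrix.specialUnitaryGroup (Fin N) ℂ))
    (hBA : D.IsBlockAveraged ℰ) (hE : ℰ.MeasurableE)
    (hB : B16.EndStatementBPrinted D.C) (hβ : BetaPertHyp D.βfun) (hsign : B16.SignConventions D.C)
    {C : T4PrintedShapeBanking.Consts} {O : PrintedO1s}
    {rr : ℕ} {β₀ : ℝ} (h : ThresholdOK C F.L rr β₀) (hμ : 0 < C.μ) (d n : ℕ)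
    (hκ₁ : (d : ℝ) * Real.log F.L + 2 * Real.log 2 ≤ C.κ₁) (hE₀ : Real.log (2 + birthMass C) ≤ C.E₀)
    (hA₀ : 1 ≤ C.A₀) (hβ₀ : 0 < β₀) (hLβ : (F.L : ℝ) * β₀ ≤ 1) (hn₁ : 13 ≤ C.n₁) (hn : 0 < n)
    {θ θv : ℝ} (hθ : 0 < θ) (hslack : C.a + (θ + θv) ≤ O.γ₀ * O.A₁ ^ 2 / 2)
    (hE₂ : 0 < C.E₂) (hE₃ : 0 ≤ C.E₃) {sS : ℕ} (hsS : 1 ≤ sS)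
    (hsmall : (((2 * cth 32 1 sS + 1) ^ d : ℕ) : ℝ) * (5 : ℝ) ^ d * ((max 1 (2 * 32 + 2) : ℕ) : ℝ) ≤
      (F.L : ℝ) ^ (sS / 2) / 2)
    {θc : ℝ} (hθc0 : 0 ≤ θc) (hθc1 : θc < 1) (hθcs : 1 / 2 ≤ θc ^ sS)
    {cΛ M Lr Φ b₀ : ℝ} {p₁ η η' κ κ₂ κᵥ : ℕ}
    (hRead : T4ContinuumYM4Torus.ForSmallCouplings D fun g₀ => ∀ os : List (ULoop F),
        ∃ (DomK : ℕ → Type) (I : (K : ℕ) → HIndex (DomK K)) (_ : DecidableEq (HIndex.Idx I)) (DomK' : ℕ → Type)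
          (I' : (K : ℕ) → HIndex (DomK' K)) (X : ℕ → Type) (_ : ∀ K, MeasurableSpace (X K))
          (μ : (K : ℕ) → Measure (X K)) (_ : ∀ K, IsFiniteMeasure (μ K)) (𝒢 : (K : ℕ) → GoodClass (X K))
          (Y : ℕ → Type) (_ : ∀ K, MeasurableSpace (Y K)) (νB : (K : ℕ) → Measure (Y K))
          (_ : ∀ K, IsFiniteMeasure (νB K)) (𝒢' : (K : ℕ) → GoodClass (Y K)),
          Nonempty (HistReadDataLWL D C O θv rr d n hn g₀ os cΛ M Lr Φ b₀ p₁ η η' κ κ₂ κᵥ I I' X μ 𝒢 Y νB 𝒢')) :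
    T4ContinuumYM4Torus.ContinuumYM4Torus D :=
  continuumYM4Torus_of_histReadingLP_fsc D hBA hE hB hβ hsign h hμ d n hκ₁ hE₀ hA₀ hβ₀ hLβ hn₁ hn hθ hslack hE₂ hE₃ hsS
    hsmall hθc0 hθc1 hθcs
    (forSmallCouplings_mono_inInterval₂ D
      (Real.exp_pos (-(ellStar C O F.L (O.d + 3) η η' κ (ApFlat O.γ₀ O.A₁ O.M Lr O.d) Φ / 2)))
      (Real.exp_pos (-(ellVolS82L C d κ₂ κᵥ cΛ M F.L θv ((1 + b₀) * F.L ^ d) (jvol82 d ((1 + b₀) * F.L ^ d)) / 2)))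
      (fun g₀ hIr hIv hg os => by
        obtain ⟨DomK, I, iI, DomK', I', X, mX, μ, hμf, 𝒢, Y, mY, νB, hνf, 𝒢', ⟨Dd⟩⟩ := hg os
        exact ⟨DomK, I, iI, DomK', I', X, mX, μ, hμf, 𝒢, Y, mY, νB, hνf, 𝒢', ⟨Dd.toLP82L hIr hIv⟩⟩)
      hRead)

end SU

end

end Summit.QuantumFields.BalabanUV.T4Continuum.HistoryRealiseCellsRunAssemblyWTVSLWLP82
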